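import Summits.BirchSwinnertonDyer.BirchSwinnertonDyer.Theses.LeadingTerm
import Summits.BirchSwinnertonDyer.BirchSwinnertonDyer.Theorems.PinchPrime.Negative.ConsequencesOfCrux
import Literature.NumberTheory.EllipticCurves.CongruentNumberOne
import Literature.NumberTheory.EllipticCurves.TunnellWaldspurgerCorollaryProofs
import Literature.NumberTheory.EllipticCurves.IwasawaLeadingTerm
import Literature.NumberTheory.EllipticCurves.KatoRankBound
import Literature.NumberTheory.EllipticCurves.SelmerCorankHolds

/-!
# `LeadingTerm.PinchPrime` (crux stmt-BirchSwinnertonDyer-16218, route `LeadingTerm`):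
# the arithmetic content of the crux — Schneider non-degeneracy AND `Ш[p^∞]` finite at the SAME
# prime — its conjunct bookkeeping, and a genuine model of its `∃`-body at `E₁ = 32a2`
# (negative-side support, refuter crux-disprover seat; this file does NOT refute the crux)

Write `S` for the crux: every elliptic `E/ℚ` (globally minimal `W`) has a good ordinary `p ≥ 5`, a
canonical cyclotomic height datum `D` at `p` and a newform `f` (`IsNewformOf W f`) with
`ord_{T=0} L_p(f, unitRoot W p, T) = rank_ℤ W(ℚ)`. Companion of `ConsequencesOfCrux` (same
directory: modularity, rank-zero BSD, parity) and of the sibling `∀ p` crux's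
`PAdicOrderPadicBSDrankR2/Negative/ShaCotorsionOfCrux`. Recorded here, sorry-free, every printed
input a HYPOTHESIS:

* §1 CONJUNCT BOOKKEEPING. `leadingTermPinchPrime_iff_goodReductionForm`: weakening `IsOrdinaryAt`
  to good reduction gives an EQUIVALENT statement (the order clause restores `p ∤ a_p`: off the
  ordinary locus `unitRoot = 0`, `L_p = 0`, order `⊤` — sibling theorem `order_ne_natCast_of_dvd`);
  `leadingTermPinchPrime_iff_without_datum`: deleting the `∃ D, D.IsCanonical` clause gives an
  EQUIVALENT statement (`exists_isCanonical_holds`). So the only content-bearing conjuncts are good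
  reduction, the newform, and the order clause.
* §2 A MODEL OF THE BODY. `leadingTermPinchPrime_instance_congruentNumberCurve_one`: for
  `E₁ : y² = x³ - x` (`rank E₁(ℚ) = 0`, Fermat — `mordellWeilRank_congruentNumberCurve_one`;
  `L(E₁,1) ≠ 0` — `entireLFunction_congruentNumberCurve_one_one_ne_zero`, whence
  `analyticRank_congruentNumberCurve_one : r_an(E₁) = 0`) and ANY `f` with `IsNewformOf E₁ f`, the
  `W := E₁` instance of `S` HOLDS (level-zero window `ord_T L_p = 0 ↔ r_an = 0`,
  `pinch_iff_analyticRank_eq_zero_of_rank_eq_zero`). The `∃`-body of `S` is satisfiable by a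
  non-junk model; no refutation can come from a rank-`0` curve with `L(E,1) ≠ 0`
  (`pinch_of_rank_zero_of_analyticRank_zero`, at EVERY good ordinary `p ≥ 5`).
* §3 THE CONTENT THEOREM. `leadingTermPinchPrime_iff_schneiderSha_somewhere`: modulo
  Perrin-Riou–Schneider (`Schneider1985_order_charGenerator`: `ord_T f_E = rank ↔ Reg_p ≠ 0 ∧
  #Ш[p^∞] < ∞`, BMS 2016 Thm 1.7), the main conjecture in ORDER form `ord_T L_p = ord_T f_E` at good
  ordinary `p ≥ 5` (Kato + Skinner–Urban / Burungale–Castella–Skinner / Rubin), the existence of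
  the cyclotomic Iwasawa datum (`X` f.g. torsion — Kato 17.4(1) —, `char X` principal) and
  modularity, `S` is EQUIVALENT to: every `E/ℚ` has a good ordinary `p ≥ 5` and THE canonical
  datum `D` with `SchneiderConjecture D` (i.e. `Reg_p(E) ≠ 0`) AND `Ш(E/ℚ)[p^∞]` finite — at ONE
  AND THE SAME prime (`schneiderSha_somewhere_of_leadingTermPinchPrime` is the forward direction
  without modularity). Two separate `∃ p` theorems would not give `S`.
* §4 KATO ONLY. `shaCotorsion_somewhere_of_leadingTermPinchPrime`: granting only Kato's corank
  bound (`kato_selmerCorank_le_order_padicLFunction`, Astérisque 295 Thm 18.4), `S` forces for every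
  `E/ℚ` a good ordinary `p ≥ 5` with `corank Sel_{p^∞}(E/ℚ) = rank E(ℚ)` and
  `corank_{ℤ_p} Ш(E/ℚ)[p^∞] = 0` (Kummer identity PROVED, `selmerCorank_eq_mordellWeilRank_add_holds`)
  — open in print for every curve of rank `≥ 2`.

No proposition is defined under `Summits/` (all variants inline).
-/

noncomputable section

-- D-0017: single-problem summit, so `Summit.BirchSwinnertonDyer.BirchSwinnertonDyer.…` repeats a
-- namespace BY DESIGN.
set_option linter.dupNamespace false

namespace Summit.BirchSwinnertonDyer.BirchSwinnertonDyer.Theorems.PinchPrime.Negative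

open scoped MatrixGroups ModularForm
open CongruenceSubgroup Literature.NumberTheory.EllipticCurves
  Literature.NumberTheory.EllipticCurves.ModularForms
open Summit.BirchSwinnertonDyer.BirchSwinnertonDyer.Theses
open Summit.BirchSwinnertonDyer.BirchSwinnertonDyer.Theorems.PAdicOrderThesisR2.Negative

/-! ## §1 Conjunct bookkeeping -/

/-- **`p ∤ a_p` is implied by the order clause**: if `ord_T L_p(f, unitRoot W p, T)` is a natural
number then `p ∤ a_p(W)` (contrapositive of `order_ne_natCast_of_dvd`: `p ∣ a_p ⇒ unitRoot = 0 ⇒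
L_p = 0 ⇒ order = ⊤`; Mazur–Tate–Teitelbaum 1986 §I.11 need an allowable root).
[cite: MazurTateTeitelbaum1986Invent, §I.11 (allowable root)] -/
theorem not_dvd_frobeniusTrace_of_order_eq_natCast (W : WeierstrassCurve ℚ) [W.IsGloballyMinimal]
    (p : ℕ) [Fact p.Prime] {N : ℕ} (f : CuspForm (Gamma0 N) 2) {r : ℕ}
    (h : (padicLFunction f (unitRoot W p : ℚ_[p])).order = r) : ¬ (p : ℤ) ∣ W.frobeniusTrace p :=
  fun hdvd => order_ne_natCast_of_dvd W p hdvd f r h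

/-- **The crux with `IsOrdinaryAt` weakened to good reduction is EQUIVALENT to the crux.**
[folklore] -/
theorem leadingTermPinchPrime_iff_goodReductionForm :
    LeadingTerm.PinchPrime ↔
      ∀ (W : WeierstrassCurve ℚ) [W.IsElliptic] [W.IsGloballyMinimal],
        ∃ (p : ℕ) (_ : Fact p.Prime), 5 ≤ p ∧ W.HasGoodReductionAtPrime p ∧
          ∃ (D : WeierstrassCurve.PAdicHeightData W p), D.IsCanonical ∧
            ∃ (N : ℕ) (_ : NeZero N) (f : CuspForm (Gamma0 N) 2), IsNewformOf W f ∧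
              (padicLFunction f (unitRoot W p : ℚ_[p])).order = W.mordellWeilRank := by
  constructor
  · intro h W _ _
    obtain ⟨p, hp, h5, hord, D, hD, N, hN, f, hf, ho⟩ := h W
    exact ⟨p, hp, h5, hord.1, D, hD, N, hN, f, hf, ho⟩
  · intro h W _ _
    obtain ⟨p, hp, h5, hgood, D, hD, N, hN, f, hf, ho⟩ := h W
    exact ⟨p, hp, h5, ⟨hgood, not_dvd_frobeniusTrace_of_order_eq_natCast W p f ho⟩,
      D, hD, N, hN, f, hf, ho⟩

/-- **The crux with the height-datum clause deleted is EQUIVALENT to the crux** (a canonical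
cyclotomic datum exists at every good ordinary `p ≥ 5`: `exists_isCanonical_holds`). [folklore] -/
theorem leadingTermPinchPrime_iff_without_datum :
    LeadingTerm.PinchPrime ↔
      ∀ (W : WeierstrassCurve ℚ) [W.IsElliptic] [W.IsGloballyMinimal],
        ∃ (p : ℕ) (_ : Fact p.Prime), 5 ≤ p ∧ IsOrdinaryAt W p ∧
          ∃ (N : ℕ) (_ : NeZero N) (f : CuspForm (Gamma0 N) 2), IsNewformOf W f ∧
            (padicLFunction f (unitRoot W p : ℚ_[p])).order = W.mordellWeilRank := by
  constructor
  · intro h W _ _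
    obtain ⟨p, hp, h5, hord, -, -, N, hN, f, hf, ho⟩ := h W
    exact ⟨p, hp, h5, hord, N, hN, f, hf, ho⟩
  · intro h W _ _
    obtain ⟨p, hp, h5, hord, N, hN, f, hf, ho⟩ := h W
    obtain ⟨D, hD⟩ := WeierstrassCurve.exists_isCanonical_holds W p h5 hord.1 hord.2
    exact ⟨p, hp, h5, hord, D, hD, N, hN, f, hf, ho⟩

/-! ## §2 A genuine model of the `∃`-body: `E₁ = 32a2` -/

/-- **`r_an(E₁) = 0`** for `E₁ : y² = x³ - x`: `L(E₁, 1) ≠ 0`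
(`entireLFunction_congruentNumberCurve_one_one_ne_zero`), so the order of vanishing at `s = 1` is
`0` (junk-robust through `analyticOrderAt_eq_zero`). [folklore] -/
theorem analyticRank_congruentNumberCurve_one : (congruentNumberCurve 1).analyticRank = 0 := by
  have h0 : analyticOrderAt (congruentNumberCurve 1).entireLFunction 1 = 0 :=
    analyticOrderAt_eq_zero.mpr (Or.inr entireLFunction_congruentNumberCurve_one_one_ne_zero)
  unfold WeierstrassCurve.analyticRank analyticOrderNatAt
  rw [h0]
  rfl

/-- **Rank-`0` curves with `L(E,1) ≠ 0` satisfy their instance of the crux at EVERY good ordinary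
`p ≥ 5`**, given the newform: the pinch clause in rank `0` is `r_an = 0`
(`pinch_iff_analyticRank_eq_zero_of_rank_eq_zero`; Mazur–Tate–Teitelbaum interpolation).
[cite: MazurTateTeitelbaum1986Invent, §I.14 (14.3) and §II.10] -/
theorem pinch_of_rank_zero_of_analyticRank_zero (W : WeierstrassCurve ℚ) [W.IsElliptic]
    [W.IsGloballyMinimal] (h0 : W.mordellWeilRank = 0) (han : W.analyticRank = 0)
    {N : ℕ} [NeZero N] (f : CuspForm (Gamma0 N) 2) (hf : IsNewformOf W f)
    (p : ℕ) [Fact p.Prime] (h5 : 5 ≤ p) (hord : IsOrdinaryAt W p) :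
    IsOrdinaryAt W p ∧ ∃ (D : WeierstrassCurve.PAdicHeightData W p), D.IsCanonical ∧
      ∃ (N : ℕ) (_ : NeZero N) (f : CuspForm (Gamma0 N) 2), IsNewformOf W f ∧
        (padicLFunction f (unitRoot W p : ℚ_[p])).order = W.mordellWeilRank := by
  obtain ⟨D, hD⟩ := WeierstrassCurve.exists_isCanonical_holds W p h5 hord.1 hord.2
  exact ⟨hord, D, hD, N, inferInstance, f, hf,
    (pinch_iff_analyticRank_eq_zero_of_rank_eq_zero W h0 p hord hf).mpr han⟩

/-- **The `W := E₁` instance of the crux HOLDS, modulo its newform.** For any `f` with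
`IsNewformOf E₁ f` (`E₁ : y² = x³ - x`, Cremona 32a2; rank `0` by Fermat, `r_an = 0`), some good
ordinary `p ≥ 5` of `E₁` (`exists_good_ordinary_prime_holds`) is a pinch prime. So the body of the
crux has a non-junk model: its hypotheses are satisfiable and its conclusion attainable.
[folklore] -/
theorem leadingTermPinchPrime_instance_congruentNumberCurve_one {N : ℕ} [NeZero N]
    (f : CuspForm (Gamma0 N) 2) (hf : IsNewformOf (congruentNumberCurve 1) f) :
    haveI : (congruentNumberCurve 1).IsGloballyMinimal :=
      isGloballyMinimal_congruentNumberCurve squarefree_one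
    ∃ (p : ℕ) (_ : Fact p.Prime), 5 ≤ p ∧ IsOrdinaryAt (congruentNumberCurve 1) p ∧
      ∃ (D : WeierstrassCurve.PAdicHeightData (congruentNumberCurve 1) p), D.IsCanonical ∧
        ∃ (N : ℕ) (_ : NeZero N) (f : CuspForm (Gamma0 N) 2), IsNewformOf (congruentNumberCurve 1) f ∧
          (padicLFunction f (unitRoot (congruentNumberCurve 1) p : ℚ_[p])).order =
            (congruentNumberCurve 1).mordellWeilRank := by
  haveI : (congruentNumberCurve 1).IsElliptic := isElliptic_congruentNumberCurve one_ne_zero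
  haveI : (congruentNumberCurve 1).IsGloballyMinimal :=
    isGloballyMinimal_congruentNumberCurve squarefree_one
  obtain ⟨p, hp, h5, hgood, hord⟩ :=
    WeierstrassCurve.exists_good_ordinary_prime_holds (congruentNumberCurve 1)
  exact ⟨p, hp, h5, pinch_of_rank_zero_of_analyticRank_zero _ mordellWeilRank_congruentNumberCurve_one
    analyticRank_congruentNumberCurve_one f hf p h5 ⟨hgood, hord⟩⟩

/-! ## §3 The content theorem: Schneider AND `Ш[p^∞]` finite at the same prime -/

section Content


/-- **`S ⇒` Schneider non-degeneracy AND `Ш[p^∞]` finite at one good ordinary `p ≥ 5` per curve**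
(modulo Perrin-Riou–Schneider, the order-IMC and the Iwasawa datum, all hypotheses; no
modularity needed): at the pinch prime `ord_T f_E = ord_T L_p = rank`, and clause 2 of
`Schneider1985_order_charGenerator` turns `ord_T f_E = rank` into `Reg_p ≠ 0 ∧ #Ш[p^∞] < ∞` for THE
canonical datum the crux carries. [cite: BalakrishnanMullerStein2015, Thm. 1.7] -/
theorem schneiderSha_somewhere_of_leadingTermPinchPrime
    (hPRS : Schneider1985_order_charGenerator)
    (hIMC : ∀ (W : WeierstrassCurve ℚ) [W.IsElliptic] [W.IsGloballyMinimal] (p : ℕ) [Fact p.Prime],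
      5 ≤ p → IsOrdinaryAt W p →
      ∀ (κ : ZpExtension ℚ p) (γ : Field.absoluteGaloisGroup ℚ),
        κ.IsCyclotomic → κ.IsTopGenerator γ → IsCyclotomicVariable p γ →
        ∀ (D : W.SelmerDualData κ γ) [Module.Finite (IwasawaAlgebra p) D.X], D.IsTorsion →
        ∀ (fE : IwasawaAlgebra p), D.charIdeal = Ideal.span {fE} →
        ∀ {N : ℕ} [NeZero N] (f : CuspForm (Gamma0 N) 2), IsNewformOf W f →
          (padicLFunction f (unitRoot W p : ℚ_[p])).order = fE.order)
    (hDat : ∀ (W : WeierstrassCurve ℚ) [W.IsElliptic] [W.IsGloballyMinimal] (p : ℕ) [Fact p.Prime],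
      5 ≤ p → IsOrdinaryAt W p →
      ∃ (κ : ZpExtension ℚ p) (γ : Field.absoluteGaloisGroup ℚ) (D : W.SelmerDualData κ γ)
        (_ : Module.Finite (IwasawaAlgebra p) D.X) (fE : IwasawaAlgebra p),
        κ.IsCyclotomic ∧ κ.IsTopGenerator γ ∧ IsCyclotomicVariable p γ ∧ D.IsTorsion ∧
          D.charIdeal = Ideal.span {fE})
    (hS : LeadingTerm.PinchPrime)
    (W : WeierstrassCurve ℚ) [W.IsElliptic] [W.IsGloballyMinimal] :
    ∃ (p : ℕ) (_ : Fact p.Prime), 5 ≤ p ∧ IsOrdinaryAt W p ∧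
      ∃ (D : WeierstrassCurve.PAdicHeightData W p), D.IsCanonical ∧
        WeierstrassCurve.SchneiderConjecture D ∧ Finite (AddCommGroup.primaryComponent W.sha p) := by
  obtain ⟨p, hp, h5, hord, Dh, hDh, N, hN, f, hf, horder⟩ := hS W
  obtain ⟨κ, γ, D, hfin, fE, hκ, hγ, hγ', hX, hfE⟩ := hDat W p h5 hord
  have h1 : (padicLFunction f (unitRoot W p : ℚ_[p])).order = fE.order :=
    hIMC W p h5 hord κ γ hκ hγ hγ' D hX fE hfE f hf
  have h2 : fE.order = W.mordellWeilRank := h1 ▸ horder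
  obtain ⟨hSch, hSha⟩ :=
    (hPRS W p h5 hord.1 hord.2 κ γ hκ hγ hγ' D hX fE hfE Dh hDh).2.1.mp h2
  exact ⟨p, hp, h5, hord, Dh, hDh, hSch, hSha⟩

/-- **The content theorem.** Modulo Perrin-Riou–Schneider, the order-IMC at good ordinary
`p ≥ 5`, the Iwasawa datum and modularity (`exists_isNewformOf`, for the `∃ f` in the converse) —
all HYPOTHESES — the crux is EQUIVALENT to "every `E/ℚ` has a good ordinary `p ≥ 5` and the
canonical datum `D` at `p` with `Reg_p(E, D) ≠ 0` AND `Ш(E/ℚ)[p^∞]` finite" (same prime).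
[cite: BalakrishnanMullerStein2015, Thm. 1.7] -/
theorem leadingTermPinchPrime_iff_schneiderSha_somewhere
    (hPRS : Schneider1985_order_charGenerator)
    (hIMC : ∀ (W : WeierstrassCurve ℚ) [W.IsElliptic] [W.IsGloballyMinimal] (p : ℕ) [Fact p.Prime],
      5 ≤ p → IsOrdinaryAt W p →
      ∀ (κ : ZpExtension ℚ p) (γ : Field.absoluteGaloisGroup ℚ),
        κ.IsCyclotomic → κ.IsTopGenerator γ → IsCyclotomicVariable p γ →
        ∀ (D : W.SelmerDualData κ γ) [Module.Finite (IwasawaAlgebra p) D.X], D.IsTorsion →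
        ∀ (fE : IwasawaAlgebra p), D.charIdeal = Ideal.span {fE} →
        ∀ {N : ℕ} [NeZero N] (f : CuspForm (Gamma0 N) 2), IsNewformOf W f →
          (padicLFunction f (unitRoot W p : ℚ_[p])).order = fE.order)
    (hDat : ∀ (W : WeierstrassCurve ℚ) [W.IsElliptic] [W.IsGloballyMinimal] (p : ℕ) [Fact p.Prime],
      5 ≤ p → IsOrdinaryAt W p →
      ∃ (κ : ZpExtension ℚ p) (γ : Field.absoluteGaloisGroup ℚ) (D : W.SelmerDualData κ γ)
        (_ : Module.Finite (IwasawaAlgebra p) D.X) (fE : IwasawaAlgebra p),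
        κ.IsCyclotomic ∧ κ.IsTopGenerator γ ∧ IsCyclotomicVariable p γ ∧ D.IsTorsion ∧
          D.charIdeal = Ideal.span {fE})
    (hmod : exists_isNewformOf) :
    LeadingTerm.PinchPrime ↔
      ∀ (W : WeierstrassCurve ℚ) [W.IsElliptic] [W.IsGloballyMinimal],
        ∃ (p : ℕ) (_ : Fact p.Prime), 5 ≤ p ∧ IsOrdinaryAt W p ∧
          ∃ (D : WeierstrassCurve.PAdicHeightData W p), D.IsCanonical ∧
            WeierstrassCurve.SchneiderConjecture D ∧
              Finite (AddCommGroup.primaryComponent W.sha p) := by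
  constructor
  · intro hS W _ _
    exact schneiderSha_somewhere_of_leadingTermPinchPrime hPRS hIMC hDat hS W
  · intro h W _ _
    obtain ⟨p, hp, h5, hord, Dh, hDh, hSch, hSha⟩ := h W
    obtain ⟨κ, γ, D, hfin, fE, hκ, hγ, hγ', hX, hfE⟩ := hDat W p h5 hord
    haveI : NeZero (W.conductorNorm ℤ) := ⟨(WeierstrassCurve.conductorNorm_pos_holds (W := W)).ne'⟩
    obtain ⟨f, hf⟩ := hmod W
    have h2 : fE.order = W.mordellWeilRank :=
      (hPRS W p h5 hord.1 hord.2 κ γ hκ hγ hγ' D hX fE hfE Dh hDh).2.1.mpr ⟨hSch, hSha⟩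
    have h1 : (padicLFunction f (unitRoot W p : ℚ_[p])).order = fE.order :=
      hIMC W p h5 hord κ γ hκ hγ hγ' D hX fE hfE f hf
    exact ⟨p, hp, h5, hord, Dh, hDh, _, inferInstance, f, hf, h1.trans h2⟩

end Content

/-! ## §4 Kato only: `Ш`-cotorsion somewhere -/

/-- **`S` + Kato's corank bound ⇒ `Ш`-cotorsion SOMEWHERE.** Granting only Kato's theorem
`corank_{ℤ_p} Sel_{p^∞}(E/ℚ) ≤ ord_T L_p(E,T)` at odd good ordinary primes (named fact
`kato_selmerCorank_le_order_padicLFunction`, hypothesis at every point), the crux gives, for every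
elliptic `E/ℚ`, a good ordinary `p ≥ 5` with `corank Sel_{p^∞}(E/ℚ) = rank E(ℚ)` and
`corank_{ℤ_p} Ш(E/ℚ)[p^∞] = 0` (Kummer identity `corank Sel = rank + corank Ш[p^∞]`, PROVED).
[cite: Kato2004, Thm 18.4] -/
theorem shaCotorsion_somewhere_of_leadingTermPinchPrime (hS : LeadingTerm.PinchPrime)
    (hK : ∀ (W : WeierstrassCurve ℚ) [W.IsElliptic] [W.IsGloballyMinimal] (p : ℕ) [Fact p.Prime]
      {N : ℕ} [NeZero N] {f : CuspForm (Gamma0 N) 2},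
      kato_selmerCorank_le_order_padicLFunction W p (f := f))
    (W : WeierstrassCurve ℚ) [W.IsElliptic] [W.IsGloballyMinimal] :
    ∃ (p : ℕ) (_ : Fact p.Prime), 5 ≤ p ∧ IsOrdinaryAt W p ∧
      W.selmerCorank p = W.mordellWeilRank ∧ W.shaCorank p = 0 := by
  obtain ⟨p, hp, h5, hord, -, -, N, hN, f, hf, horder⟩ := hS W
  have hk := hK W p (f := f) (by omega) hord hf
  rw [horder] at hk
  have h1 : W.selmerCorank p ≤ W.mordellWeilRank := by exact_mod_cast hk
  have h2 := W.selmerCorank_eq_mordellWeilRank_add_holds p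
  exact ⟨p, hp, h5, hord, by omega, by omega⟩

end Summit.BirchSwinnertonDyer.BirchSwinnertonDyer.Theorems.PinchPrime.Negative

end
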